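import Literature.MathematicalPhysics.StatisticalMechanics.LayerSumDecay
import Literature.MathematicalPhysics.StatisticalMechanics.HcpFccLatticeSumsTail

/-!
# `OverbindingBudget` / crux `RobustDefectLimitWindows` (stmt-AtomisticToContinuum-31280) — «TwinGain» part S: the homogeneity bridge

Support file (lens-4 g84, residual programme «AffineRunCut», instrument literal **TGI** `IdealTwinGain` of
`…OverbindingBudgetAffineTwinCut` §6: `2·J₂(a) + 4·∑_{k ≥ 3} |J_k(a)| ≤ −c₀` on `a ∈ [17/20, 2]`,
`J_k(a) = barlowCoupling lennardJones a (a√(2/3)) k`).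

THE BRIDGE.  At the ideal layer spacing `h = a·√(2/3)` the Literature identity `normSq_layerVec`
(`…LayerSumDecay`) reads `‖layerVec a h δ k i j‖² = a²·(stackForm δ i j + 2k²/3)` for the two patterns `δ ∈ {0, 1}`
(`stackForm` of the audited `StackingSums` kit, `…HcpFccLatticeSums`), and the tree's Lennard-Jones
`lennardJones r = (1/12) r⁻¹² − (1/6) r⁻⁶` is a difference of two homogeneous inverse powers.  Hence, termwise and after `tsum`,

  `barlowCoupling lennardJones a (a√(2/3)) k = (1/12)·(a⁻¹)¹²·registryCoupling 6 s − (1/6)·(a⁻¹)⁶·registryCoupling 3 s`,  `s = 2k²/3`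

(`barlowCoupling_lennardJones_ideal`; NO hypothesis on `a` or `k` — at `k = 0` both sides carry the junk-free value `0⁻¹ = 0` at the omitted
site), and the interval certificate of TGI collapses to ONE quadratic inequality in `u = a⁻⁶` with the certified registry couplings of
`…HcpFccLatticeSumsNumJ3a / …Num6` and of part E (`…TwinGainEnclosures`) as coefficients (part C, `…TwinGainCertificate`).
[this file: 6 theorems; no definitions; standard axioms]
-/

namespace Summit.AtomisticToContinuum.Crystallization.Theorems.OverbindingBudgetAffineTwinGainScaling

open Literature.MathematicalPhysics.StatisticalMechanics
open Literature.MathematicalPhysics.StatisticalMechanics.StackingSums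

/-- The planar form of `normSq_layerVec` IS the kit's pattern form for the two patterns `δ ∈ {0,1}` (`δ² = δ`):
`(i + j/2 + δ/2)² + ¾ (j + δ/3)² = i² + ij + j² + δ (i + j + 1/3) = stackForm δ i j`. [this file · kind: proof] -/
theorem planar_eq_stackForm {δ : ℕ} (hδ : δ ≤ 1) (i j : ℤ) :
    ((i : ℝ) + j / 2 + ((δ : ℤ) : ℝ) / 2) ^ 2 + 3 / 4 * ((j : ℝ) + ((δ : ℤ) : ℝ) / 3) ^ 2 = stackForm δ i j := by
  unfold stackForm
  interval_cases δ <;> push_cast <;> ring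

/-- **Squared norms at the ideal spacing**: `‖layerVec a (a√(2/3)) δ k i j‖² = a²·(stackForm δ i j + 2k²/3)` (`δ ≤ 1`).
[this file · kind: proof] -/
theorem normSq_layerVec_ideal {δ : ℕ} (hδ : δ ≤ 1) (a : ℝ) (k i j : ℤ) :
    ‖layerVec a (a * Real.sqrt (2 / 3)) δ k i j‖ ^ 2 = a ^ 2 * (stackForm δ i j + (k : ℝ) ^ 2 * (2 / 3)) := by
  rw [normSq_layerVec, ← planar_eq_stackForm hδ]
  have h : Real.sqrt (2 / 3) ^ 2 = 2 / 3 := Real.sq_sqrt (by norm_num)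
  linear_combination (k : ℝ) ^ 2 * a ^ 2 * h

/-- **Homogeneity of Lennard-Jones**: if `r² = a²·t` then `lennardJones r = (1/12)(a⁻¹)¹²(t⁻¹)⁶ − (1/6)(a⁻¹)⁶(t⁻¹)³` — a formal identity
(no sign or non-vanishing hypothesis: `0⁻¹ = 0` on both sides). [this file · kind: proof] -/
theorem lennardJones_of_sq {r a t : ℝ} (h : r ^ 2 = a ^ 2 * t) :
    lennardJones r = 1 / 12 * (a⁻¹) ^ 12 * (t⁻¹) ^ 6 - 1 / 6 * (a⁻¹) ^ 6 * (t⁻¹) ^ 3 := by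
  have e12 : (r⁻¹) ^ 12 = (a⁻¹) ^ 12 * (t⁻¹) ^ 6 := by
    rw [show (r⁻¹) ^ 12 = ((r ^ 2)⁻¹) ^ 6 by ring, h]; ring
  have e6 : (r⁻¹) ^ 6 = (a⁻¹) ^ 6 * (t⁻¹) ^ 3 := by
    rw [show (r⁻¹) ^ 6 = ((r ^ 2)⁻¹) ^ 3 by ring, h]; ring
  unfold lennardJones
  rw [e12, e6]; ring

/-- **Termwise identity**: the Lennard-Jones energy of the layer vector is the combination of two layer terms of the kit,
`V_LJ ‖layerVec a (a√(2/3)) δ k i j‖ = (1/12)(a⁻¹)¹²·layerTerm δ 6 (2k²/3) (i,j) − (1/6)(a⁻¹)⁶·layerTerm δ 3 (2k²/3) (i,j)`.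
[this file · kind: proof] -/
theorem lennardJones_layerVec_ideal {δ : ℕ} (hδ : δ ≤ 1) (a : ℝ) (k : ℤ) (ij : ℤ × ℤ) :
    lennardJones ‖layerVec a (a * Real.sqrt (2 / 3)) δ k ij.1 ij.2‖ =
      1 / 12 * (a⁻¹) ^ 12 * layerTerm δ 6 ((k : ℝ) ^ 2 * (2 / 3)) ij
        - 1 / 6 * (a⁻¹) ^ 6 * layerTerm δ 3 ((k : ℝ) ^ 2 * (2 / 3)) ij := by
  unfold layerTerm
  exact lennardJones_of_sq (normSq_layerVec_ideal hδ a k ij.1 ij.2)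

/-- **Layer interactions at the ideal spacing are layer sums of the kit**:
`layerInteraction lennardJones a (a√(2/3)) δ k = (1/12)(a⁻¹)¹²·layerSum δ 6 (2k²/3) − (1/6)(a⁻¹)⁶·layerSum δ 3 (2k²/3)` (`δ ≤ 1`;
both layer families are summable by `layerTerm_summable`, `…HcpFccLatticeSumsTail`). [this file · kind: proof] -/
theorem layerInteraction_lennardJones_ideal {δ : ℕ} (hδ : δ ≤ 1) (a : ℝ) (k : ℤ) :
    layerInteraction lennardJones a (a * Real.sqrt (2 / 3)) δ k =
      1 / 12 * (a⁻¹) ^ 12 * layerSum δ 6 ((k : ℝ) ^ 2 * (2 / 3))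
        - 1 / 6 * (a⁻¹) ^ 6 * layerSum δ 3 ((k : ℝ) ^ 2 * (2 / 3)) := by
  unfold layerInteraction layerSum
  have hs : (0 : ℝ) ≤ (k : ℝ) ^ 2 * (2 / 3) := by positivity
  have h6 := (layerTerm_summable hδ hs (n := 6) (by norm_num)).mul_left (1 / 12 * (a⁻¹) ^ 12)
  have h3 := (layerTerm_summable hδ hs (n := 3) (by norm_num)).mul_left (1 / 6 * (a⁻¹) ^ 6)
  rw [← tsum_mul_left, ← tsum_mul_left, ← h6.tsum_sub h3]
  exact tsum_congr fun ij => lennardJones_layerVec_ideal hδ a k ij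

/-- **The interlayer couplings at the ideal spacing are registry couplings of the kit** (the bridge):
`barlowCoupling lennardJones a (a√(2/3)) k = (1/12)(a⁻¹)¹²·registryCoupling 6 s − (1/6)(a⁻¹)⁶·registryCoupling 3 s` for `2k²/3 = s`
(the caller chooses the literal form of `s`, e.g. `50/3` at `k = 5`). [this file · kind: proof] -/
theorem barlowCoupling_lennardJones_ideal (a : ℝ) (k : ℕ) {s : ℝ} (hs : (k : ℝ) ^ 2 * (2 / 3) = s) :
    barlowCoupling lennardJones a (a * Real.sqrt (2 / 3)) k =
      1 / 12 * (a⁻¹) ^ 12 * registryCoupling 6 s - 1 / 6 * (a⁻¹) ^ 6 * registryCoupling 3 s := by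
  subst hs
  unfold barlowCoupling registryCoupling
  have h0 := layerInteraction_lennardJones_ideal (δ := 0) (by norm_num) a (k : ℤ)
  have h1 := layerInteraction_lennardJones_ideal (δ := 1) (by norm_num) a (k : ℤ)
  push_cast at h0 h1
  rw [h0, h1]
  ring

/-- **Absolute bound through the bridge**: `|J_k(a)| ≤ (1/12)(a⁻¹)¹²·β₆ + (1/6)(a⁻¹)⁶·β₃` whenever `|registryCoupling 6 s| ≤ β₆` and
`|registryCoupling 3 s| ≤ β₃`, `2k²/3 = s`. [this file · kind: proof] -/
theorem abs_barlowCoupling_lennardJones_ideal_le (a : ℝ) (k : ℕ) {s β₃ β₆ : ℝ} (hs : (k : ℝ) ^ 2 * (2 / 3) = s)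
    (h3 : |registryCoupling 3 s| ≤ β₃) (h6 : |registryCoupling 6 s| ≤ β₆) :
    |barlowCoupling lennardJones a (a * Real.sqrt (2 / 3)) k| ≤
      1 / 12 * (a⁻¹) ^ 12 * β₆ + 1 / 6 * (a⁻¹) ^ 6 * β₃ := by
  rw [barlowCoupling_lennardJones_ideal a k hs]
  have p12 : 0 ≤ 1 / 12 * (a⁻¹) ^ 12 := by positivity
  have p6 : 0 ≤ 1 / 6 * (a⁻¹) ^ 6 := by positivity
  calc |1 / 12 * (a⁻¹) ^ 12 * registryCoupling 6 s - 1 / 6 * (a⁻¹) ^ 6 * registryCoupling 3 s|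
      ≤ |1 / 12 * (a⁻¹) ^ 12 * registryCoupling 6 s| + |1 / 6 * (a⁻¹) ^ 6 * registryCoupling 3 s| := abs_sub _ _
    _ = 1 / 12 * (a⁻¹) ^ 12 * |registryCoupling 6 s| + 1 / 6 * (a⁻¹) ^ 6 * |registryCoupling 3 s| := by
        rw [abs_mul (1 / 12 * (a⁻¹) ^ 12), abs_mul (1 / 6 * (a⁻¹) ^ 6), abs_of_nonneg p12, abs_of_nonneg p6]
    _ ≤ 1 / 12 * (a⁻¹) ^ 12 * β₆ + 1 / 6 * (a⁻¹) ^ 6 * β₃ :=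
        add_le_add (mul_le_mul_of_nonneg_left h6 p12) (mul_le_mul_of_nonneg_left h3 p6)

/-- **Signed form for the driving coupling**: `J_k(a) ≤ (1/12)(a⁻¹)¹²·B₆ − (1/6)(a⁻¹)⁶·b₃` whenever `registryCoupling 6 s ≤ B₆` and
`b₃ ≤ registryCoupling 3 s` (used at `k = 2`, where `J₂ < 0` is the hcp preference). [this file · kind: proof] -/
theorem barlowCoupling_lennardJones_ideal_le (a : ℝ) (k : ℕ) {s b₃ B₆ : ℝ} (hs : (k : ℝ) ^ 2 * (2 / 3) = s)
    (h3 : b₃ ≤ registryCoupling 3 s) (h6 : registryCoupling 6 s ≤ B₆) :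
    barlowCoupling lennardJones a (a * Real.sqrt (2 / 3)) k ≤
      1 / 12 * (a⁻¹) ^ 12 * B₆ - 1 / 6 * (a⁻¹) ^ 6 * b₃ := by
  rw [barlowCoupling_lennardJones_ideal a k hs]
  have p12 : 0 ≤ 1 / 12 * (a⁻¹) ^ 12 := by positivity
  have p6 : 0 ≤ 1 / 6 * (a⁻¹) ^ 6 := by positivity
  have := mul_le_mul_of_nonneg_left h6 p12
  have := mul_le_mul_of_nonneg_left h3 p6
  linarith

end Summit.AtomisticToContinuum.Crystallization.Theorems.OverbindingBudgetAffineTwinGainScaling
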